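import Mathlib
import HarnessLib
import Summits.AtomisticToContinuum.Crystallization.Theorems.PricedLinkCensusSoftFourRingsCapCertD8Data
import Summits.AtomisticToContinuum.Crystallization.Theorems.PricedLinkCensusSoftFourRingsCapCertD8Exp1
import Summits.AtomisticToContinuum.Crystallization.Theorems.PricedLinkCensusSoftFourRingsCapCertD8Exp2
import Summits.AtomisticToContinuum.Crystallization.Theorems.PricedLinkCensusSoftFourRingsCapCertD8Exp3
import Summits.AtomisticToContinuum.Crystallization.Theorems.PricedLinkCensusSoftFourRingsCapCertD8Exp4
import Summits.AtomisticToContinuum.Crystallization.Theorems.PricedLinkCensusSoftFourRingsCapCertD8Exp5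
import Summits.AtomisticToContinuum.Crystallization.Theorems.PricedLinkCensusSoftFourRingsCapCertD8Exp6
import Summits.AtomisticToContinuum.Crystallization.Theorems.PricedLinkCensusSoftFourRingsCapCertD8Exp7
import Summits.AtomisticToContinuum.Crystallization.Theorems.PricedLinkCensusSoftFourRingsCapCertD8Exp8
import Summits.AtomisticToContinuum.Crystallization.Theorems.PricedLinkCensusSoftFourRingsCapCertD8Exp9
import Summits.AtomisticToContinuum.Crystallization.Theorems.PricedLinkCensusSoftFourRingsCapCertD8Exp10
import Summits.AtomisticToContinuum.Crystallization.Theorems.PricedLinkCensusSoftFourRingsCapCertD8Exp11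
import Summits.AtomisticToContinuum.Crystallization.Theorems.PricedLinkCensusSoftFourRingsCapCertD8Exp12
import Summits.AtomisticToContinuum.Crystallization.Theorems.PricedLinkCensusSoftFourRingsCapCertD8Exp13
import Summits.AtomisticToContinuum.Crystallization.Theorems.PricedLinkCensusSoftFourRingsCapCertD8Exp14
import Summits.AtomisticToContinuum.Crystallization.Theorems.PricedLinkCensusSoftFourRingsCapCertD8Exp15
import Summits.AtomisticToContinuum.Crystallization.Theorems.PricedLinkCensusSoftFourRingsCapCertD8Exp16
import Summits.AtomisticToContinuum.Crystallization.Theorems.PricedLinkCensusSoftFourRingsCapCertD8Exp17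
import Summits.AtomisticToContinuum.Crystallization.Theorems.PricedLinkCensusSoftFourRingsCapCertD8Exp18
import Summits.AtomisticToContinuum.Crystallization.Theorems.PricedLinkCensusSoftFourRingsCapCertD8Exp19
import Summits.AtomisticToContinuum.Crystallization.Theorems.PricedLinkCensusSoftFourRingsCapCertD8Exp20

/-!
# Bond-to-cap certificate (Step 11)

Route `PricedLinkCensus`, item `SoftFourRings` (stmt-AtomisticToContinuum-14234), crux `Cap.BondToCap`:
integer data / kernel checks of the pole-centred semidefinite certificate (format `CapCert`,
expansion mode of `PricedLinkCensusSoftFourRingsCapCertDefs`), produced by the seat's solver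
(`work/compute/sdp`, `phase2.py`, `emit_lean2.py`).
-/

namespace Summit.AtomisticToContinuum.Crystallization.Theorems.Cap.Cert.D8

open Literature.Geometry.DiscreteGeometry Literature.Geometry.DiscreteGeometry.PolyCert
  Literature.Geometry.DiscreteGeometry.PolyCert.SPoly

set_option maxRecDepth 100000 in
set_option maxHeartbeats 0 in
/-- Row chunk `[60, 80)` of `theCert_gn2`. [folklore] -/
theorem step_gn2_3 : chunkOK theCert_gn2 60 20 P_gn2_2 P_gn2_3 = true := by decide +kernel

set_option maxRecDepth 100000 in
set_option maxHeartbeats 0 in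
/-- Row chunk `[80, 100)` of `theCert_gn2`. [folklore] -/
theorem step_gn2_4 : chunkOK theCert_gn2 80 20 P_gn2_3 P_gn2_4 = true := by decide +kernel

set_option maxRecDepth 100000 in
set_option maxHeartbeats 0 in
/-- Row chunk `[100, 120)` of `theCert_gn2`. [folklore] -/
theorem step_gn2_5 : chunkOK theCert_gn2 100 20 P_gn2_4 P_gn2_5 = true := by decide +kernel

set_option maxRecDepth 100000 in
set_option maxHeartbeats 0 in
/-- Row chunk `[0, 20)` of `theCert_gn3`. [folklore] -/
theorem step_gn3_0 : chunkOK theCert_gn3 0 20 [] P_gn3_0 = true := by decide +kernel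

set_option maxRecDepth 100000 in
set_option maxHeartbeats 0 in
/-- Row chunk `[20, 40)` of `theCert_gn3`. [folklore] -/
theorem step_gn3_1 : chunkOK theCert_gn3 20 20 P_gn3_0 P_gn3_1 = true := by decide +kernel

set_option maxRecDepth 100000 in
set_option maxHeartbeats 0 in
/-- Row chunk `[40, 60)` of `theCert_gn3`. [folklore] -/
theorem step_gn3_2 : chunkOK theCert_gn3 40 20 P_gn3_1 P_gn3_2 = true := by decide +kernel

end Summit.AtomisticToContinuum.Crystallization.Theorems.Cap.Cert.D8
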